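import Mathlib
import Summits.MatrixMultiplication.MatrixMultiplication.Theorems.SnSubsetDichotomyPolynomialSlackCylinderMarginals

/-!
# Common-value bumps from a heavy pair entry

Crux `Summit.MatrixMultiplication.MatrixMultiplication.Theses.SnSubsetDichotomy.PolynomialSlack`
(item `stmt-MatrixMultiplication-8306`), level-one programme, lead c5, line transport-split-hull.
For `X, Y ⊆ S_n` and positions `i, j` the pair marginal `m_{XY}(i,j) = #{(x,y) ∈ X × Y : y j = x i}`
factors over the common value `v = x i = y j` as `Σ_v c_X(i→v)·c_Y(j→v)` (`pairMarginal_eq_sum_mul`),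
where `c_X(i→v) = #{x ∈ X : x i = v}` and `Σ_v c_X(i→v) = |X|`, `Σ_v c_Y(j→v) = |Y|`
(`sum_marginal_col`). Cauchy–Schwarz with the largest term pulled out
(`exists_sq_sum_mul_le_sum_mul_sum_mul`) then produces a value `v` with
`m_{XY}(i,j)² ≤ |X|·|Y|·c_X(i→v)·c_Y(j→v)` (`commonValueBumps`): a heavy pair entry forces a pair of
point bumps of `X` at `i` and of `Y` at `j` towards a COMMON value.
-/

namespace Summit.MatrixMultiplication.MatrixMultiplication.Theorems.PolynomialSlack

set_option linter.dupNamespace false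

open scoped BigOperators

/-- Cauchy–Schwarz with the largest term pulled out: for nonnegative `a, b` on a finite nonempty index
type there is an index `v` with `(Σ_w a_w b_w)² ≤ (Σ_w a_w)·(Σ_w b_w)·(a_v b_v)`. Indeed, with `v`
maximising `a_w b_w`, termwise `(a_w b_w)² ≤ a_w·(a_v b_v·b_w)`, and Cauchy–Schwarz. [folklore] -/
theorem exists_sq_sum_mul_le_sum_mul_sum_mul {ι : Type*} [Fintype ι] [Nonempty ι] (a b : ι → ℝ)
    (ha : ∀ w, 0 ≤ a w) (hb : ∀ w, 0 ≤ b w) :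
    ∃ v : ι, (∑ w, a w * b w) ^ 2 ≤ (∑ w, a w) * (∑ w, b w) * (a v * b v) := by
  obtain ⟨v, -, hv⟩ := Finset.exists_max_image Finset.univ (fun w => a w * b w) Finset.univ_nonempty
  refine ⟨v, ?_⟩
  calc (∑ w, a w * b w) ^ 2 ≤ (∑ w, a w) * ∑ w, a v * b v * b w :=
        Finset.sum_sq_le_sum_mul_sum_of_sq_le_mul Finset.univ (fun w _ => ha w)
          (fun w _ => mul_nonneg (mul_nonneg (ha v) (hb v)) (hb w))
          (fun w _ => by
            have h : a w * b w ≤ a v * b v := hv w (Finset.mem_univ w)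
            calc (a w * b w) ^ 2 = a w * ((a w * b w) * b w) := by ring
              _ ≤ a w * ((a v * b v) * b w) :=
                mul_le_mul_of_nonneg_left (mul_le_mul_of_nonneg_right h (hb w)) (ha w))
    _ = (∑ w, a w) * (∑ w, b w) * (a v * b v) := by rw [← Finset.mul_sum]; ring

/-- **Common-value bumps from a heavy pair entry.** For `X, Y ⊆ S_n` and positions `i, j` there is a
value `v` with `#{(x,y) ∈ X × Y : y j = x i}² ≤ |X|·|Y|·#{x ∈ X : x i = v}·#{y ∈ Y : y j = v}`:
the pair marginal is `Σ_v c_X(i→v)·c_Y(j→v)` (`pairMarginal_eq_sum_mul`) with `Σ_v c_X(i→v) = |X|`,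
`Σ_v c_Y(j→v) = |Y|` (`sum_marginal_col`), and Cauchy–Schwarz with the largest term pulled out
(`exists_sq_sum_mul_le_sum_mul_sum_mul`; `Fin n` is nonempty as it holds `i`). [folklore] -/
theorem commonValueBumps {n : ℕ} (X Y : Finset (Equiv.Perm (Fin n))) (i j : Fin n) :
    ∃ v : Fin n, ((((X ×ˢ Y).filter fun xy => xy.2 j = xy.1 i).card : ℕ) : ℝ) ^ 2 ≤
      ((X.card * Y.card : ℕ) : ℝ) *
        (((X.filter fun x => x i = v).card : ℝ) * ((Y.filter fun y => y j = v).card : ℝ)) := by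
  haveI : Nonempty (Fin n) := ⟨i⟩
  obtain ⟨v, hv⟩ := exists_sq_sum_mul_le_sum_mul_sum_mul
    (fun v : Fin n => ((X.filter fun x => x i = v).card : ℝ))
    (fun v : Fin n => ((Y.filter fun y => y j = v).card : ℝ))
    (fun _ => Nat.cast_nonneg _) (fun _ => Nat.cast_nonneg _)
  refine ⟨v, ?_⟩
  rw [← pairMarginal_eq_sum_mul X Y i j, sum_marginal_col X i, sum_marginal_col Y j] at hv
  rw [Nat.cast_mul]
  exact hv

end Summit.MatrixMultiplication.MatrixMultiplication.Theorems.PolynomialSlack
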